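import Mathlib
import HarnessLib
import Summits.NavierStokesRegularity.NavierStokesRegularity.Theses.RootDecompAxisLogGauge
import Summits.NavierStokesRegularity.NavierStokesRegularity.Theorems.RootDecompAxisLogGaugeLogGaugeCriterionStubExtensionOfLocallyBounded

/-!
# RootDecompAxisLogGauge — crux `LogGaugeCriterion` (stmt-NavierStokesRegularity-25378) is ONE registered stub, in the tree

The registered BC3 skeleton of the LOG-GAUGE CRITERION (writer g10, skeleton sha `c47262ef8b16…`) has two
stubs: `stub_logGaugePointBounded` (the mathematics: Lei–Ren's 2024 question — an axisymmetric classical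
Leray–Hopf solution whose scaled gradient energy `E(r; T, x₀) ≤ C·|ln r|` at a point `x₀` is bounded in a
backward parabolic neighbourhood of `(T, x₀)`; open, L) and `stub_extension_of_locallyBounded` (continuation
bookkeeping), the latter PROVED in the tree by writer g13
(`Theorems.LogGaugeCriterion.stub_extension_of_locallyBounded`, Lemarié-Rieusset 2016 Thm 15.1 (C) /
Albritton 2018 Cor 4.6). The skeleton's composition `LogGaugeCriterion_of` lives only in the (unlanded)
skeleton file; this file lands it: the born route decl `Theses.RootDecompAxisLogGauge.LogGaugeCriterion`
follows from the registered signature of `stub_logGaugePointBounded`, taken VERBATIM as a hypothesis (no new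
definition), by one application of the landed continuation stub. Hence the crux ⟨25378⟩ — the ATTACKED jaw
of the lens-1 AxisLogGaugePincer (census rows C16/H18) — is, in the tree and by name, exactly the one open
stub. Conditional; credits nothing; Navier–Stokes regularity is NOT proved by anything here (rung 0).
decomp-ns census instrument g26. [cite: arXiv:2210.01783, p. 6 (Lei–Ren 2024, the |ln r| question);
LemarieRieusset2016, Thm. 15.1 (C)]
-/

-- the summit and its single sub-problem share the name (CONVENTIONS §1), as in every Theorems file
set_option linter.dupNamespace false

namespace Summit.NavierStokesRegularity.NavierStokesRegularity.Theorems.LogGaugeCriterion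

/-- **Crux ⟨25378⟩ modulo its one mathematical stub.** The registered signature of
`stub_logGaugePointBounded` (hypothesis `hPB`, verbatim: log-gauge bound on the scaled gradient energy at
`x₀` ⇒ `u` bounded on a backward parabolic neighbourhood of `(T, x₀)`, for axisymmetric classical Leray–Hopf
solutions from rapidly decaying data) implies the route decl `LogGaugeCriterion`: apply it at every point and
continue past `T` by the landed stub `stub_extension_of_locallyBounded`. [skeleton `LogGaugeCriterion_of`,
writer g10; continuation: LemarieRieusset2016 Thm 15.1 (C)] -/
theorem logGaugeCriterion_of_stubLogGaugePointBounded
    (hPB : ∀ (ν T : ℝ), 0 < ν → 0 < T →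
      ∀ (u : ℝ → EuclideanSpace ℝ (Fin 3) → EuclideanSpace ℝ (Fin 3)) (p : ℝ → EuclideanSpace ℝ (Fin 3) → ℝ),
      Literature.Analysis.FluidPDE.IsClassicalNSSolutionOn (Set.Ico 0 T) ν 0 u p →
      Literature.Analysis.FluidPDE.IsLerayHopfOn T ν 0 (u 0) u →
      Literature.Analysis.FluidPDE.HasRapidSpatialDecay (u 0) →
      (∃ (Q : EuclideanSpace ℝ (Fin 3) ≃ₗᵢ[ℝ] EuclideanSpace ℝ (Fin 3)) (c : EuclideanSpace ℝ (Fin 3)),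
        ∀ t ∈ Set.Ico 0 T, Literature.Analysis.FluidPDE.IsAxisymmetric (fun y => Q.symm (u t (c + Q y)))) →
      ∀ x₀ : EuclideanSpace ℝ (Fin 3),
      (∃ C r₀ : ℝ, 0 < r₀ ∧ ∀ r ∈ Set.Ioo 0 r₀,
        Literature.Analysis.FluidPDE.cknE r ((T, x₀) : ℝ × EuclideanSpace ℝ (Fin 3))
          (fun t x => fderiv ℝ (u t) x) ≤ ENNReal.ofReal (C * |Real.log r|)) →
      ∃ ρ M : ℝ, 0 < ρ ∧ ∀ t ∈ Set.Ioo (T - ρ ^ 2) T, ∀ x ∈ Metric.ball x₀ ρ, ‖u t x‖ ≤ M) :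
    Theses.RootDecompAxisLogGauge.LogGaugeCriterion := by
  intro ν T hν hT u p hc hl hd hax hlog
  exact stub_extension_of_locallyBounded ν T hν hT u p hc hl hd
    (fun x₀ => hPB ν T hν hT u p hc hl hd hax x₀ (hlog x₀))

/-- **The AxisLogGauge cone by name, modulo the one stub.** With the composition above, the route's deciding
theorem reads: Clay (A) ⟸ `OffAxisNoBlowup` (25380, declared residual) ∧ the registered stub signature of
`stub_logGaugePointBounded` ∧ `LogGaugeCoverage` (25379, declared residual). [route `closes`, writer g2] -/
theorem navierStokesRegularity_of_offAxis_stub_coverage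
    (h₁ : Theses.RootDecompAxisLogGauge.OffAxisNoBlowup)
    (hPB : ∀ (ν T : ℝ), 0 < ν → 0 < T →
      ∀ (u : ℝ → EuclideanSpace ℝ (Fin 3) → EuclideanSpace ℝ (Fin 3)) (p : ℝ → EuclideanSpace ℝ (Fin 3) → ℝ),
      Literature.Analysis.FluidPDE.IsClassicalNSSolutionOn (Set.Ico 0 T) ν 0 u p →
      Literature.Analysis.FluidPDE.IsLerayHopfOn T ν 0 (u 0) u →
      Literature.Analysis.FluidPDE.HasRapidSpatialDecay (u 0) →
      (∃ (Q : EuclideanSpace ℝ (Fin 3) ≃ₗᵢ[ℝ] EuclideanSpace ℝ (Fin 3)) (c : EuclideanSpace ℝ (Fin 3)),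
        ∀ t ∈ Set.Ico 0 T, Literature.Analysis.FluidPDE.IsAxisymmetric (fun y => Q.symm (u t (c + Q y)))) →
      ∀ x₀ : EuclideanSpace ℝ (Fin 3),
      (∃ C r₀ : ℝ, 0 < r₀ ∧ ∀ r ∈ Set.Ioo 0 r₀,
        Literature.Analysis.FluidPDE.cknE r ((T, x₀) : ℝ × EuclideanSpace ℝ (Fin 3))
          (fun t x => fderiv ℝ (u t) x) ≤ ENNReal.ofReal (C * |Real.log r|)) →
      ∃ ρ M : ℝ, 0 < ρ ∧ ∀ t ∈ Set.Ioo (T - ρ ^ 2) T, ∀ x ∈ Metric.ball x₀ ρ, ‖u t x‖ ≤ M)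
    (h₃ : Theses.RootDecompAxisLogGauge.LogGaugeCoverage) : _root_.NavierStokesRegularity :=
  Theses.RootDecompAxisLogGauge.closes h₁ (logGaugeCriterion_of_stubLogGaugePointBounded hPB) h₃

end Summit.NavierStokesRegularity.NavierStokesRegularity.Theorems.LogGaugeCriterion
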